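import Literature.RepresentationTheory.BorelWallach2000.U11ContragredientMultiplicity
import Literature.Algebra.Module.SocleRadical
import HarnessLib

/-!
# Socle and top are exchanged by the contragredient: `(soc M)^⊥ = rad(M~)`, `(rad M)^⊥ = soc(M~)`, `(top M)~ ≅ soc(M~)`,
# `(soc M)~ ≅ top(M~)` for admissible `(𝔤, K)`-modules of `U(1,1)` (Borel–Wallach 0 §2.5; Krause, Conventions «Socle», «Radical»)

Family `hodge`, lane `lit-hodgefound` (foundations library; seat `lit-hodgefound-p39`, generation 33, row g33-#5); topic
`RepresentationTheory/BorelWallach2000`, namespace `…BorelWallach2000.U11DualFunctor` (continued).  Sequel of g32-#9/#10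
(`U11ContragredientAnnihilator(Lattice)`: `U^⊥`, `(M/U)~ ≅ U^⊥`, `U~ ≅ M~/U^⊥`, the lattice anti-isomorphism
`annOrderIso : Sub_R(M) ≃o Sub_R(M~)ᵒᵈ` for admissible `M`), of g33-#4 (`Literature.Algebra.Module.SocleRadical`: `socle`, Mathlib's
`Module.jacobson` as the radical, and their exchange `ofDual_map_socle` / `ofDual_map_jacobson` under ANY anti-isomorphism of
submodule lattices) and of g33-#3 (`[M~ : L~] = [M : L]`).  What is formalised: for an admissible `(𝔤, K)`-module `M` of `U(1,1)` over the
operator ring `R = GKRing G11` — `(soc M)^⊥ = rad(M~)`, `(rad M)^⊥ = soc(M~)`, `R`-isomorphisms `(M/rad M)~ ≅ soc(M~)` and `(soc M)~ ≅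
M~/rad(M~)`, the top `M/rad M` of an admissible module is SEMISIMPLE (the socle is, and semisimplicity passes through `~`), the socle of
`M~` is simple iff the top of `M` is, and `[soc(M~) : L~] = [top M : L]`.  Definitions with bodies (the two named equivalences) + theorems;
0 `sorry`, no named fact (net debt 0, D-0026).

## The sources

Borel–Wallach [BorelWallach2000, 0 §2.5, I §2.2] (the contragredient `(𝔤, K)`-module; `Ṽ` of admissible `V`); Getz–Hahn [GetzHahn2024, §5.4]
(admissible duality); Knapp–Vogan [KnappVogan1995, §II.3 Prop. 2.53 (b)] (exactness of `W ↦ W^c`); Krause [Krause2021, Conventions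
«Socle», «Radical»] (`soc`, `rad`, `top = X/rad X`); Berrick–Keating [BerrickKeating2000, §4.1.13] (socle, semisimple `= soc`).  The exchange
itself is the lattice statement g33-#4 `ofDual_map_socle/jacobson` instantiated at `annOrderIso` — proved here, not quoted.

## What is formalised (`G = U(1,1)`, `R = GKRing G11`, `M~ = GKDual.dualModule`)

* §1 **`ann_socle : (soc M)^⊥ = rad(M~)`**, **`ann_jacobson : (rad M)^⊥ = soc(M~)`** (admissible `M`), `perp_socle`, `perp_jacobson`.
* §2 **`topDualEquivSocle : (M ⧸ rad M)~ ≃ₗ[R] soc(M~)`**, **`socleDualEquivTop : (soc M)~ ≃ₗ[R] M~ ⧸ rad(M~)`**.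
* §3 **`isSemisimpleModule_top`**: `M ⧸ rad M` is semisimple for admissible `M` (its contragredient is the semisimple `soc(M~)`);
  `isSimpleModule_socle_dualModule_iff` (`soc(M~)` simple ⟺ `top M` simple), `socle_dualModule_eq_bot_iff` (`soc(M~) = 0 ⟺ rad M = M`).
* §4 multiplicities: **`compMult_socle_dualModule : [soc(M~) : L~] = [M ⧸ rad M : L]`**, `compMult_top_dualModule : [M~ ⧸ rad(M~) : L~] =
  [soc M : L]`.

## Mathlib / Literature search

g32-#9 `GKDual.quotDualEquivAnn`, `subDualEquivQuotAnn`; g32-#10 `annOrderIso(_apply)`, `perp_ann`, `isSemisimpleModule_dualModule_iff`; g32-#9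
`isSimpleModule_dualModule_iff`; `U11HC.isAdmissibleGK_submodule/_quotient`; g33-#3 `compMult_dualModule`; g33-#4 `socle`, `ofDual_map_socle`,
`ofDual_map_jacobson`, `isSemisimpleModule_socle`; Mathlib `Module.jacobson`, `LinearEquiv.ofEq`, `Submodule.quotEquivOfEq`,
`IsSemisimpleModule.congr`, `IsSimpleModule.congr`.  `rg -n 'ann_socle|topDualEquivSocle|socleDualEquivTop'` → nothing in the tree.

## References

* A. Borel, N. Wallach, *Continuous Cohomology, Discrete Subgroups, and Representations of Reductive Groups*, 2nd ed., AMS (2000),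
  0 §2.5, I §2.2. [BorelWallach2000]
* H. Krause, *Homological Theory of Representations*, CUP (2021), Conventions and Notations («Socle», «Radical»). [Krause2021]
* A. J. Berrick, M. E. Keating, *An Introduction to Rings and Modules*, CUP (2000), §4.1.13. [BerrickKeating2000]
* A. W. Knapp, D. A. Vogan, *Cohomological Induction and Unitary Representations* (1995), §II.3 Prop. 2.53 (b). [KnappVogan1995]
* J. R. Getz, H. Hahn, *An Introduction to Automorphic Representations*, GTM 300 (2024), §5.4. [GetzHahn2024]
-/

noncomputable section

open scoped Matrix ComplexConjugate
open Module

namespace Literature.RepresentationTheory.BorelWallach2000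

open Literature.Algebra.Lie Literature.Algebra.Lie.ChevalleyEilenberg
open Literature.Algebra.Module
open Literature.NumberTheory.Automorphic
open Literature.RepresentationTheory.KonnoKonno2007 Literature.RepresentationTheory.KonnoKonno2007.RealDualPair
open Literature.RepresentationTheory.KonnoKonno2007.RealDualPair.UForm
open Literature.LinearAlgebra
open U11HolDS

-- Mathlib idiom (as in `GKModules`, `GKCohomology`): commutator bracket on `Module.End` / matrices
attribute [local instance 100] LieRing.ofAssociativeRing

namespace U11DualFunctor

variable {M : Type*} [AddCommGroup M] [Module ℂ M] [Module (GKRing G11) M] [IsScalarTower ℂ (GKRing G11) M]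
  (hM : IsGKModule G11 (GKRing.actK G11 M) (GKRing.actLie G11 M))
  {L : Type*} [AddCommGroup L] [Module ℂ L] [Module (GKRing G11) L] [IsScalarTower ℂ (GKRing G11) L]
  (hL : IsGKModule G11 (GKRing.actK G11 L) (GKRing.actLie G11 L))

/-! ## §1 `(soc M)^⊥ = rad(M~)` and `(rad M)^⊥ = soc(M~)` -/

/-- **`(soc M)^⊥ = rad(M~)`** for an admissible `(𝔤, K)`-module `M` of `U(1,1)`: the anti-isomorphism `U ↦ U^⊥` of submodule lattices
(g32-#10) sends the sum of the minimal submodules to the intersection of the maximal ones (g33-#4). [cite: BorelWallach2000, 0 §2.5, I §2.2]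
[cite: Krause2021, Conventions «Socle», «Radical»] -/
theorem ann_socle (hadm : IsAdmissibleGK (GKRing.actK G11 M)) :
    GKDual.ann G11 hM (SocleRadical.socle (GKRing G11) M) = Module.jacobson (GKRing G11) (GKDual.dualModule G11 hM) := by
  rw [← annOrderIso_apply hM hadm]
  exact SocleRadical.ofDual_map_socle (annOrderIso hM hadm)

/-- **`(rad M)^⊥ = soc(M~)`** for an admissible `(𝔤, K)`-module `M` of `U(1,1)`. [cite: BorelWallach2000, 0 §2.5, I §2.2]
[cite: Krause2021, Conventions «Socle», «Radical»] -/
theorem ann_jacobson (hadm : IsAdmissibleGK (GKRing.actK G11 M)) :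
    GKDual.ann G11 hM (Module.jacobson (GKRing G11) M) = SocleRadical.socle (GKRing G11) (GKDual.dualModule G11 hM) := by
  rw [← annOrderIso_apply hM hadm]
  exact SocleRadical.ofDual_map_jacobson (annOrderIso hM hadm)

/-- Dually, `(soc(M~))_⊥ = rad M`. [cite: BorelWallach2000, 0 §2.5, I §2.2] [cite: Krause2021, Conventions «Socle», «Radical»] -/
theorem perp_socle (hadm : IsAdmissibleGK (GKRing.actK G11 M)) :
    GKDual.perp G11 hM (SocleRadical.socle (GKRing G11) (GKDual.dualModule G11 hM)) = Module.jacobson (GKRing G11) M := by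
  rw [← ann_jacobson hM hadm, perp_ann]

/-- … and `(rad(M~))_⊥ = soc M`. [cite: BorelWallach2000, 0 §2.5, I §2.2] [cite: Krause2021, Conventions «Socle», «Radical»] -/
theorem perp_jacobson (hadm : IsAdmissibleGK (GKRing.actK G11 M)) :
    GKDual.perp G11 hM (Module.jacobson (GKRing G11) (GKDual.dualModule G11 hM)) = SocleRadical.socle (GKRing G11) M := by
  rw [← ann_socle hM hadm, perp_ann]

/-! ## §2 `(top M)~ ≅ soc(M~)` and `(soc M)~ ≅ top(M~)` -/

/-- **`(M ⧸ rad M)~ ≅ soc(M~)` over `R`** for admissible `M`: `(M/U)~ ≅ U^⊥` (g32-#9) at `U = rad M`, and `(rad M)^⊥ = soc(M~)`.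
[cite: BorelWallach2000, 0 §2.5, I §2.2] [cite: KnappVogan1995, §II.3 Prop. 2.53 (b)] [cite: Krause2021, Conventions «Socle», «Radical»] -/
def topDualEquivSocle (hadm : IsAdmissibleGK (GKRing.actK G11 M)) :
    GKDual.dualModule G11 (GKRing.isGKModule_quotient G11 M (Module.jacobson (GKRing G11) M) hM) ≃ₗ[GKRing G11]
      SocleRadical.socle (GKRing G11) (GKDual.dualModule G11 hM) :=
  GKDual.quotDualEquivAnn G11 hM (Module.jacobson (GKRing G11) M) ≪≫ₗ LinearEquiv.ofEq _ _ (ann_jacobson hM hadm)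

/-- **`(soc M)~ ≅ M~ ⧸ rad(M~)` over `R`** for admissible `M`: `U~ ≅ M~/U^⊥` (g32-#9) at `U = soc M`, and `(soc M)^⊥ = rad(M~)`.
[cite: BorelWallach2000, 0 §2.5, I §2.2] [cite: KnappVogan1995, §II.3 Prop. 2.53 (b)] [cite: Krause2021, Conventions «Socle», «Radical»] -/
def socleDualEquivTop (hadm : IsAdmissibleGK (GKRing.actK G11 M)) :
    GKDual.dualModule G11 (GKRing.isGKModule_submodule G11 M (SocleRadical.socle (GKRing G11) M) hM) ≃ₗ[GKRing G11]
      GKDual.dualModule G11 hM ⧸ Module.jacobson (GKRing G11) (GKDual.dualModule G11 hM) :=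
  subDualEquivQuotAnn hM (SocleRadical.socle (GKRing G11) M) ≪≫ₗ Submodule.quotEquivOfEq _ _ (ann_socle hM hadm)

/-! ## §3 The top of an admissible module is semisimple; simple socle versus simple top -/

include hM in
/-- **The top `M ⧸ rad M` of an admissible `(𝔤, K)`-module of `U(1,1)` is semisimple**: its contragredient is `soc(M~)`, which is semisimple
(g33-#4), and semisimplicity passes through `~` for admissible modules (g32-#10). [cite: BorelWallach2000, 0 §2.5, I §2.2]
[cite: BerrickKeating2000, §4.1.13] [cite: Krause2021, Conventions «Radical»] -/
theorem isSemisimpleModule_top (hadm : IsAdmissibleGK (GKRing.actK G11 M)) :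
    IsSemisimpleModule (GKRing G11) (M ⧸ Module.jacobson (GKRing G11) M) := by
  have hQ := GKRing.isGKModule_quotient G11 M (Module.jacobson (GKRing G11) M) hM
  have hQadm := U11HC.isAdmissibleGK_quotient hM hadm (Module.jacobson (GKRing G11) M)
  haveI : IsSemisimpleModule (GKRing G11) ↥(SocleRadical.socle (GKRing G11) (GKDual.dualModule G11 hM)) :=
    SocleRadical.isSemisimpleModule_socle _ _
  have h1 : IsSemisimpleModule (GKRing G11) (GKDual.dualModule G11 hQ) :=
    IsSemisimpleModule.congr (R := GKRing G11) (M := ↥(SocleRadical.socle (GKRing G11) (GKDual.dualModule G11 hM)))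
      (N := GKDual.dualModule G11 hQ) (topDualEquivSocle hM hadm)
  exact (isSemisimpleModule_dualModule_iff hQ hQadm).mp h1

/-- The socle of an admissible module is semisimple — and so is, consistently, `M~ ⧸ rad(M~) ≅ (soc M)~`.
[cite: BorelWallach2000, 0 §2.5] [cite: BerrickKeating2000, §4.1.13] -/
theorem isSemisimpleModule_top_dualModule (hadm : IsAdmissibleGK (GKRing.actK G11 M)) :
    IsSemisimpleModule (GKRing G11) (GKDual.dualModule G11 hM ⧸ Module.jacobson (GKRing G11) (GKDual.dualModule G11 hM)) := by
  have hS := GKRing.isGKModule_submodule G11 M (SocleRadical.socle (GKRing G11) M) hM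
  have hSadm := U11HC.isAdmissibleGK_submodule hM hadm (SocleRadical.socle (GKRing G11) M)
  have hsoc : IsSemisimpleModule (GKRing G11) ↥(SocleRadical.socle (GKRing G11) M) := SocleRadical.isSemisimpleModule_socle _ _
  have h1 : IsSemisimpleModule (GKRing G11) (GKDual.dualModule G11 hS) := (isSemisimpleModule_dualModule_iff hS hSadm).mpr hsoc
  exact IsSemisimpleModule.congr (R := GKRing G11) (M := GKDual.dualModule G11 hS)
    (N := GKDual.dualModule G11 hM ⧸ Module.jacobson (GKRing G11) (GKDual.dualModule G11 hM)) (socleDualEquivTop hM hadm).symm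

/-- **`soc(M~)` is simple iff the top `M ⧸ rad M` is simple** (admissible `M`; `(top M)~ ≅ soc(M~)` and simplicity passes through `~`,
g32-#9). [cite: BorelWallach2000, 0 §2.5, I §2.2] [cite: Krause2021, Conventions «Socle», «Radical»] -/
theorem isSimpleModule_socle_dualModule_iff (hadm : IsAdmissibleGK (GKRing.actK G11 M)) :
    IsSimpleModule (GKRing G11) ↥(SocleRadical.socle (GKRing G11) (GKDual.dualModule G11 hM)) ↔
      IsSimpleModule (GKRing G11) (M ⧸ Module.jacobson (GKRing G11) M) := by
  have hQ := GKRing.isGKModule_quotient G11 M (Module.jacobson (GKRing G11) M) hM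
  rw [← isSimpleModule_dualModule_iff hQ]
  exact ⟨fun h => IsSimpleModule.congr (R := GKRing G11) (M := GKDual.dualModule G11 hQ)
      (N := ↥(SocleRadical.socle (GKRing G11) (GKDual.dualModule G11 hM))) (topDualEquivSocle hM hadm),
    fun h => IsSimpleModule.congr (R := GKRing G11) (M := ↥(SocleRadical.socle (GKRing G11) (GKDual.dualModule G11 hM)))
      (N := GKDual.dualModule G11 hQ) (topDualEquivSocle hM hadm).symm⟩

/-- **`top(M~)` is simple iff `soc M` is simple** (admissible `M`). [cite: BorelWallach2000, 0 §2.5, I §2.2] [cite: Krause2021, Conventions «Socle», «Radical»] -/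
theorem isSimpleModule_top_dualModule_iff (hadm : IsAdmissibleGK (GKRing.actK G11 M)) :
    IsSimpleModule (GKRing G11) (GKDual.dualModule G11 hM ⧸ Module.jacobson (GKRing G11) (GKDual.dualModule G11 hM)) ↔
      IsSimpleModule (GKRing G11) ↥(SocleRadical.socle (GKRing G11) M) := by
  have hS := GKRing.isGKModule_submodule G11 M (SocleRadical.socle (GKRing G11) M) hM
  rw [← isSimpleModule_dualModule_iff hS]
  exact ⟨fun h => IsSimpleModule.congr (R := GKRing G11) (M := GKDual.dualModule G11 hS)
      (N := GKDual.dualModule G11 hM ⧸ Module.jacobson (GKRing G11) (GKDual.dualModule G11 hM)) (socleDualEquivTop hM hadm),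
    fun h => IsSimpleModule.congr (R := GKRing G11)
      (M := GKDual.dualModule G11 hM ⧸ Module.jacobson (GKRing G11) (GKDual.dualModule G11 hM))
      (N := GKDual.dualModule G11 hS) (socleDualEquivTop hM hadm).symm⟩

/-- `soc(M~) = 0 ⟺ rad M = M` (admissible `M`): `(rad M)^⊥ = soc(M~)` and `U^⊥ = 0 ⟺ U = M`. [cite: BorelWallach2000, 0 §2.5, I §2.2]
[cite: Krause2021, Conventions «Socle», «Radical»] -/
theorem socle_dualModule_eq_bot_iff (hadm : IsAdmissibleGK (GKRing.actK G11 M)) :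
    SocleRadical.socle (GKRing G11) (GKDual.dualModule G11 hM) = ⊥ ↔ Module.jacobson (GKRing G11) M = ⊤ := by
  rw [← ann_jacobson hM hadm, ← GKDual.ann_top G11 hM]
  exact (ann_injective hM).eq_iff

/-- `rad(M~) = M~ ⟺ soc M = 0` (admissible `M`). [cite: BorelWallach2000, 0 §2.5, I §2.2] [cite: Krause2021, Conventions «Socle», «Radical»] -/
theorem jacobson_dualModule_eq_top_iff (hadm : IsAdmissibleGK (GKRing.actK G11 M)) :
    Module.jacobson (GKRing G11) (GKDual.dualModule G11 hM) = ⊤ ↔ SocleRadical.socle (GKRing G11) M = ⊥ := by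
  rw [← ann_socle hM hadm, ← GKDual.ann_bot G11 hM]
  exact (ann_injective hM).eq_iff

/-! ## §4 Multiplicities: `[soc(M~) : L~] = [top M : L]` -/

/-- **`[soc(M~) : L~] = [M ⧸ rad M : L]`** for admissible `M` and every `(𝔤, K)`-module `L` (`(top M)~ ≅ soc(M~)` and `[N~ : L~] = [N : L]`,
g33-#3). [cite: BorelWallach2000, 0 §2.5, I §2.2] [cite: BerrickKeating2000, §4.1.11, §4.1.13] [cite: Krause2021, Conventions «Socle», «Radical»] -/
theorem compMult_socle_dualModule (hadm : IsAdmissibleGK (GKRing.actK G11 M)) :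
    JordanHoelder.compMult (GKRing G11) (SocleRadical.socle (GKRing G11) (GKDual.dualModule G11 hM)) (GKDual.dualModule G11 hL) =
      JordanHoelder.compMult (GKRing G11) (M ⧸ Module.jacobson (GKRing G11) M) L := by
  have hQ := GKRing.isGKModule_quotient G11 M (Module.jacobson (GKRing G11) M) hM
  rw [← JordanHoelder.compMult_congr_left (R := GKRing G11) (M := GKDual.dualModule G11 hQ)
    (N := ↥(SocleRadical.socle (GKRing G11) (GKDual.dualModule G11 hM))) (GKDual.dualModule G11 hL) (topDualEquivSocle hM hadm),
    compMult_dualModule hQ hL]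

/-- **`[M~ ⧸ rad(M~) : L~] = [soc M : L]`** for admissible `M`. [cite: BorelWallach2000, 0 §2.5, I §2.2] [cite: BerrickKeating2000, §4.1.11, §4.1.13]
[cite: Krause2021, Conventions «Socle», «Radical»] -/
theorem compMult_top_dualModule (hadm : IsAdmissibleGK (GKRing.actK G11 M)) :
    JordanHoelder.compMult (GKRing G11) (GKDual.dualModule G11 hM ⧸ Module.jacobson (GKRing G11) (GKDual.dualModule G11 hM))
        (GKDual.dualModule G11 hL) =
      JordanHoelder.compMult (GKRing G11) (SocleRadical.socle (GKRing G11) M) L := by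
  have hS := GKRing.isGKModule_submodule G11 M (SocleRadical.socle (GKRing G11) M) hM
  rw [← JordanHoelder.compMult_congr_left (R := GKRing G11) (M := GKDual.dualModule G11 hS)
    (N := GKDual.dualModule G11 hM ⧸ Module.jacobson (GKRing G11) (GKDual.dualModule G11 hM)) (GKDual.dualModule G11 hL)
    (socleDualEquivTop hM hadm), compMult_dualModule hS hL]

end U11DualFunctor

end Literature.RepresentationTheory.BorelWallach2000
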